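import Summits.Ventures.CertifiedArithmetic.Expansions.Orient2dBlocks
import Literature.ComputerArithmetic.Shewchuk1997.Orient2dStageA
import Literature.ComputerArithmetic.Shewchuk1997.Compress
import Literature.ComputerArithmetic.BoldoJeannerodMelquiondMuller2023.CorrectRoundingHalfUlp
import Literature.ComputerArithmetic.JoldesMullerPopescu2017.DWTimesFP
import Mathlib.Tactic.Linarith
import Mathlib.Tactic.Positivity
import Mathlib.Tactic.Ring
import Mathlib.Tactic.NormNum

/-!
# `estimate()` never returns the wrong strict sign on a TWO-TWO-DIFF block (ORIENT2D stages B and "tails zero")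

NEW WORK (not a published theorem; the algorithms are Shewchuk's, the statements and proofs are ours).

In `predicates.c` the adaptive stage of ORIENT2D (`orient2dadapt`) forms the four-component block
`B = Two_Two_Diff(Two_Product(acx, bcy), Two_Product(acy, bcx))` on the ROUNDED coordinate differences
and approximates it with a single float `det = estimate(4, B)`, where `estimate(elen, e)` is the plain
left-to-right floating-point sum `Q ⇐ e₀; Q ⇐ Q ⊕ eᵢ`.  That `det` is RETURNED in two places: by the
stage-B test `|det| ≥ ccwerrboundB ⊗ detsum`, and unconditionally when all four coordinate-difference
tails vanish (`if ((acxtail == 0.0) && (acytail == 0.0) && (bcxtail == 0.0) && (bcytail == 0.0))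
return det;` — then `B` is the exact determinant).  Shewchuk justifies both with the remark (§2.7,
APPROXIMATE) that the floating-point sum of a nonoverlapping expansion has relative error `< 2ε`.
For a GENERAL nonoverlapping expansion that remark does not even give the sign: with `p = 4`,
`⟨15/16, 15, −16⟩` is nonoverlapping and increasing, its sum is `−1/16`, and
`estimate = (15/16 ⊕ 15) ⊖ 16 = 16 ⊖ 16 = 0`.  What saves `orient2dadapt` is the SHAPE of `B`: its
top two components `(B₃, B₂)` are the output of one TWO-SUM, so `|B₂| ≤ ½ulp(B₃)`.

THIS FILE proves, for any precision `p ≥ 1` and any round-to-nearest `fl` (any tie rule, gradual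
underflow included — every quantity is a float, so no range hypothesis is needed):

* `estimate_four_sign`: if `[b₀, b₁, b₂, b₃]` is a nonoverlapping (`IsExpansion 1`) list of floats with
  `fl (b₃ + b₂) = b₃` (the TWO-SUM shape of the top pair), then `estimate > 0 → Σ > 0` and
  `estimate < 0 → Σ < 0`: the estimate is `0` or has the sign of the exact sum.  (Proof: the partial
  estimate `Q₂ = (b₀ ⊕ b₁) ⊕ b₂` satisfies `|Q₂| ≤ |b₃|` — if `b₂ = 0` because `|b₀ + b₁|` lies below the
  quantum of `b₃`, else because `|b₀ ⊕ b₁| ≤ |b₂| ≤ ½ulp(b₃)` gives `|Q₂| ≤ ulp(b₃) ≤ |b₃|` — so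
  `Q₂ + b₃`, hence `det`, is `0` or has the sign of `b₃`, which is the sign of `Σ` (§2.8 sign test).)
* `twoTwoDiff_eq` (the four components of TWO-TWO-DIFF as TWO-SUM outputs), `estimate_twoTwoDiff_sign`
  and `estimate_twoTwoProdDiff_sign`: the block `B` of `orient2dadapt` has that shape, so
  `sign(estimate B) ∈ {sign ΣB, 0}` with `ΣB = x₁x₂ − x₃x₄` exactly (error-free two-products).
* `orient2dDetB_sign`: consequently the stage-B value `det` of `orient2dadapt`, whenever it is nonzero,
  has the sign of the determinant `x₁x₂ − x₃x₄` of the ROUNDED differences; and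
  `orient2d_tailsZero_sign` / `orient2d_tailsZero_fma`: when the four differences are themselves floats
  (all tails zero) a nonzero `det` has the sign of the TRUE determinant
  `(a₁ − c₁)(b₂ − c₂) − (a₂ − c₂)(b₁ − c₁)` — the "tails zero" exit of `predicates.c` never returns a
  wrong strict sign.

HONEST CAVEATS.  (1) Not proved here: that `det ≠ 0` at the tails-zero exit whenever the true
determinant is nonzero (a returned `0` would be a wrong "collinear"; exhaustive small searches —
`p = 4`: 96 066 near-equal product pairs, `p = 5`: 453 878 — found no such case, but it is open in
this development), and the stage-B error bound itself (`ccwerrboundB = (2 + 12ε)ε`, Table 1 line B: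
that `|det| ≥ ccwerrboundB ⊗ detsum` forces `sign(x₁x₂ − x₃x₄) = sign` of the true determinant).
(2) Overflow is not modelled (unbounded exponents above).  Stage A is
`Literature/…/Shewchuk1997/Orient2dStageA.lean`, stage D is `Orient2d.lean` / `Orient2dPredicates.lean`.

References: J. R. Shewchuk, Discrete Comput. Geom. 18 (1997) 305–363, §2.7 (APPROXIMATE), §2.8
(sign test), §4.3 Fig. 21 and `predicates.c` (`estimate`, `orient2dadapt`) [Shewchuk1997].
-/

namespace Summit.Ventures.CertifiedArithmetic.Expansions

open Literature.ComputerArithmetic.JeannerodRump2018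
open Literature.ComputerArithmetic.BoldoJeannerodMelquiondMuller2023 hiding twoSum twoSum_fst isFloat_twoSum
open Literature.ComputerArithmetic.JoldesMullerPopescu2017 (isFloat_two_zpow abs_fl_le_of_abs_le)
open Literature.ComputerArithmetic.Shewchuk1997

variable {p : ℕ} {emin : ℤ} {fl : ℚ → ℚ}

/-! ## `estimate()` -/

/-- `predicates.c`'s `estimate(elen, e)`: `Q = e[0]; for (i = 1; i < elen; i++) Q += e[i];` in
floating point — the one-word approximation of an expansion (APPROXIMATE of §2.7 without the
largest-first reordering; `predicates.c` sums smallest first). `estimate [] = 0` by convention. -/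
def estimate (fl : ℚ → ℚ) : List ℚ → ℚ
  | [] => 0
  | e :: es => es.foldl (fun Q x => fl (Q + x)) e

/-- `estimate(4, b) = ((b₀ ⊕ b₁) ⊕ b₂) ⊕ b₃`. -/
theorem estimate_four (fl : ℚ → ℚ) (b₀ b₁ b₂ b₃ : ℚ) :
    estimate fl [b₀, b₁, b₂, b₃] = fl (fl (fl (b₀ + b₁) + b₂) + b₃) := rfl

/-! ## Two small facts (monotone rounding against a float bound and `ulp(b) ≤ |b|` are
`JoldesMullerPopescu2017.abs_fl_le_of_abs_le` and `Shewchuk1997.ulp_le_abs_of_isFloat`) -/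

/-- A number on the grids `2^s ℤ` and `2^s' ℤ` is on the grid `2^max(s, s') ℤ`. -/
theorem onGrid_max {s s' : ℤ} {y : ℚ} (hs : OnGrid s y) (hs' : OnGrid s' y) :
    OnGrid (max s s') y := by
  rcases le_total s s' with h | h
  · rwa [max_eq_right h]
  · rwa [max_eq_left h]

/-- **Two components below a third.** If the floats `b₀, b₁` are nonoverlapping (`b₀` below `b₁`) and
both lie below the nonzero float `y` (each `< 2^s` for a quantum `2^s` of `y`), then `|b₀ + b₁| < |y|`
and — the sum being below a float power of two dividing `y` — `|b₀ ⊕ b₁| ≤ |y|`. -/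
theorem abs_fl_add_le_of_below (hp : 1 ≤ p) (hfl : IsRoundNearest p emin fl) {b₀ b₁ y : ℚ}
    (h₀ : IsFloat p emin b₀) (h₁ : IsFloat p emin b₁) (hy : IsFloat p emin y) (hy0 : y ≠ 0)
    (h01 : Below 1 b₀ b₁) (h0y : Below 1 b₀ y) (h1y : Below 1 b₁ y) :
    |b₀ + b₁| < |y| ∧ |fl (b₀ + b₁)| ≤ |y| := by
  obtain ⟨s₀, hs₀, hg₀, hlt₀⟩ := h0y.normalize hy
  obtain ⟨s₁, hs₁, hg₁, hlt₁⟩ := h1y.normalize hy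
  rw [one_mul] at hlt₀ hlt₁
  have hg : OnGrid (max s₀ s₁) y := onGrid_max hg₀ hg₁
  have two0 : (0 : ℚ) < 2 := by norm_num
  have hb : ∀ x ∈ [b₀, b₁], |x| < (2 : ℚ) ^ (max s₀ s₁) := by
    intro x hx
    simp only [List.mem_cons, List.mem_nil_iff, or_false] at hx
    rcases hx with rfl | rfl
    · exact lt_of_lt_of_le hlt₀ (zpow_le_zpow_right₀ (by norm_num) (le_max_left _ _))
    · exact lt_of_lt_of_le hlt₁ (zpow_le_zpow_right₀ (by norm_num) (le_max_right _ _))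
  have hexp : IsExpansion 1 [b₀, b₁] := List.pairwise_pair.mpr h01
  have hF : ∀ x ∈ [b₀, b₁], IsFloat p emin x := forall_mem_pair h₀ h₁
  have hsum := abs_sum_lt_two_zpow_of_isExpansion hF hexp hb
  simp only [List.sum_cons, List.sum_nil, add_zero] at hsum
  have hle : (2 : ℚ) ^ (max s₀ s₁) ≤ |y| := hg.two_zpow_le_abs hy0
  refine ⟨lt_of_lt_of_le hsum hle, ?_⟩
  exact (abs_fl_le_of_abs_le hfl (isFloat_two_zpow hp (le_max_of_le_left hs₀)) hsum.le).trans hle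

/-! ## The sign of `estimate` on a four-component block with a TWO-SUM top pair -/

/-- **`estimate` IS ZERO OR HAS THE SIGN OF THE SUM** on a nonoverlapping list of four floats
`[b₀, b₁, b₂, b₃]` (smallest first) whose top pair has the TWO-SUM shape `fl (b₃ + b₂) = b₃`.
Any round-to-nearest, any precision `p ≥ 1`, gradual underflow included. -/
theorem estimate_four_sign (hp : 1 ≤ p) (hfl : IsRoundNearest p emin fl) {b₀ b₁ b₂ b₃ : ℚ}
    (h₀ : IsFloat p emin b₀) (h₁ : IsFloat p emin b₁) (h₂ : IsFloat p emin b₂)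
    (h₃ : IsFloat p emin b₃) (hexp : IsExpansion 1 [b₀, b₁, b₂, b₃]) (htop : fl (b₃ + b₂) = b₃) :
    (0 < estimate fl [b₀, b₁, b₂, b₃] → 0 < b₀ + b₁ + b₂ + b₃) ∧
      (estimate fl [b₀, b₁, b₂, b₃] < 0 → b₀ + b₁ + b₂ + b₃ < 0) := by
  rw [estimate_four]
  -- the six pairwise gap conditions
  have hpw := hexp
  simp only [IsExpansion, List.pairwise_cons, List.mem_cons, List.mem_nil_iff, or_false,
    forall_eq_or_imp, forall_eq, List.Pairwise.nil, and_true] at hpw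
  obtain ⟨⟨h01, h02, h03⟩, ⟨h12, h13⟩, h23⟩ := hpw
  have hQ1F : IsFloat p emin (fl (b₀ + b₁)) := (hfl _).1
  by_cases hb3 : b₃ = 0
  · -- then `b₂ = 0` (it rounds into `b₃ = 0`) and the estimate is `b₀ ⊕ b₁`, an honest rounding
    subst hb3
    have hb2 : b₂ = 0 := by rw [zero_add, fl_eq_self hfl h₂] at htop; exact htop
    subst hb2
    have hQ2 : fl (fl (b₀ + b₁) + 0) = fl (b₀ + b₁) := by rw [add_zero, fl_eq_self hfl hQ1F]
    rw [hQ2, hQ2, add_zero, add_zero]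
    have hg : OnGrid emin (b₀ + b₁) := (OnGrid.of_isFloat h₀).add (OnGrid.of_isFloat h₁)
    exact ⟨(fl_pos_iff_of_onGrid hp hfl le_rfl hg).mp, (fl_neg_iff_of_onGrid hp hfl le_rfl hg).mp⟩
  · -- `b₃ ≠ 0`: the sum has the sign of `b₃` (sign test) and `|Q₂| ≤ |b₃|`
    have hlow : |b₀ + b₁ + b₂| < |b₃| := by
      have h := abs_sum_lt_abs_of_isExpansion (l := [b₀, b₁, b₂]) (t := b₃)
        (by
          intro x hx
          simp only [List.mem_cons, List.mem_nil_iff, or_false] at hx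
          rcases hx with rfl | rfl | rfl
          exacts [h₀, h₁, h₂]) h₃ hb3 hexp
      simpa [List.sum_cons, add_assoc] using h
    have hQ2 : |fl (fl (b₀ + b₁) + b₂)| ≤ |b₃| := by
      by_cases hb2 : b₂ = 0
      · rw [hb2, add_zero, fl_eq_self hfl hQ1F]
        exact (abs_fl_add_le_of_below hp hfl h₀ h₁ h₃ hb3 h01 h03 h13).2
      · have hQ1 : |fl (b₀ + b₁)| ≤ |b₂| := (abs_fl_add_le_of_below hp hfl h₀ h₁ h₂ hb2 h01 h02 h12).2
        have hhalf : |b₂| ≤ ulp p emin b₃ / 2 := by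
          have h := abs_sub_fl_le_half_ulp_fl hp hfl (b₃ + b₂)
          rwa [htop, add_sub_cancel_left] at h
        have hin : |fl (b₀ + b₁) + b₂| ≤ ulp p emin b₃ :=
          (abs_add_le _ _).trans (by linarith)
        exact (abs_fl_le_of_abs_le hfl (isFloat_ulp hp b₃) hin).trans (ulp_le_abs_of_isFloat h₃ hb3)
    rcases lt_or_gt_of_ne hb3 with hneg | hpos
    · -- `b₃ < 0`: `Q₂ + b₃ ≤ 0`, so the estimate is `≤ 0`, and the sum is `< 0`
      rw [abs_of_neg hneg] at hlow hQ2
      have hle : fl (fl (fl (b₀ + b₁) + b₂) + b₃) ≤ 0 := by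
        have h := fl_mono hfl (show fl (fl (b₀ + b₁) + b₂) + b₃ ≤ 0 by
          linarith [(abs_le.mp hQ2).2])
        rwa [fl_zero hfl] at h
      refine ⟨fun h => absurd h (not_lt.mpr hle), fun _ => ?_⟩
      linarith [(abs_lt.mp hlow).2]
    · -- `b₃ > 0`: symmetric
      rw [abs_of_pos hpos] at hlow hQ2
      have hge : 0 ≤ fl (fl (fl (b₀ + b₁) + b₂) + b₃) :=
        fl_nonneg hfl (by linarith [(abs_le.mp hQ2).1])
      refine ⟨fun _ => ?_, fun h => absurd h (not_lt.mpr hge)⟩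
      linarith [(abs_lt.mp hlow).1]

/-! ## The TWO-TWO-DIFF block has the required shape -/

/-- The four components of TWO-TWO-DIFF `(a₁ + a₀) − (b₁ + b₀)` = EXPANSION-SUM(⟨a₀, a₁⟩, ⟨−b₀, −b₁⟩)
as TWO-SUM outputs: with `T₁ = TWO-SUM(−b₀, a₀)`, `T₂ = TWO-SUM(T₁.hi, a₁)`, `T₃ = TWO-SUM(−b₁, T₂.lo)`,
`T₄ = TWO-SUM(T₃.hi, T₂.hi)` the block is `⟨T₁.lo, T₃.lo, T₄.lo, T₄.hi⟩`. -/
theorem twoTwoDiff_eq (fl : ℚ → ℚ) (a₁ a₀ b₁ b₀ : ℚ) :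
    twoTwoDiff fl a₁ a₀ b₁ b₀ =
      [(twoSum fl (-b₀) a₀).2,
        (twoSum fl (-b₁) (twoSum fl (twoSum fl (-b₀) a₀).1 a₁).2).2,
        (twoSum fl (twoSum fl (-b₁) (twoSum fl (twoSum fl (-b₀) a₀).1 a₁).2).1
          (twoSum fl (twoSum fl (-b₀) a₀).1 a₁).1).2,
        (twoSum fl (twoSum fl (-b₁) (twoSum fl (twoSum fl (-b₀) a₀).1 a₁).2).1
          (twoSum fl (twoSum fl (-b₀) a₀).1 a₁).1).1] := by
  simp only [twoTwoDiff, expansionSum_cons_cons, growExpansion_cons, growExpansion_nil,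
    expansionSum_nil_right]

/-- **SIGN OF `estimate` ON A TWO-TWO-DIFF BLOCK.** If the block is nonoverlapping (e.g. because the
operands are floats forming weakly nonoverlapping pairs: Theorem 5 / `expansionSum_isWeakExpansion`),
then `estimate > 0 → Σ > 0` and `estimate < 0 → Σ < 0` (every component is a TWO-SUM output, hence a
float, and the top pair is one TWO-SUM). -/
theorem estimate_twoTwoDiff_sign (hp : 1 ≤ p) (hfl : IsRoundNearest p emin fl) {a₁ a₀ b₁ b₀ : ℚ}
    (hexp : IsExpansion 1 (twoTwoDiff fl a₁ a₀ b₁ b₀)) :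
    (0 < estimate fl (twoTwoDiff fl a₁ a₀ b₁ b₀) → 0 < (twoTwoDiff fl a₁ a₀ b₁ b₀).sum) ∧
      (estimate fl (twoTwoDiff fl a₁ a₀ b₁ b₀) < 0 → (twoTwoDiff fl a₁ a₀ b₁ b₀).sum < 0) := by
  rw [twoTwoDiff_eq] at hexp ⊢
  have hT1 := isFloat_twoSum hfl (-b₀) a₀
  have hT2 := isFloat_twoSum hfl (twoSum fl (-b₀) a₀).1 a₁
  have hT3 := isFloat_twoSum hfl (-b₁) (twoSum fl (twoSum fl (-b₀) a₀).1 a₁).2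
  have hT4 := isFloat_twoSum hfl (twoSum fl (-b₁) (twoSum fl (twoSum fl (-b₀) a₀).1 a₁).2).1
    (twoSum fl (twoSum fl (-b₀) a₀).1 a₁).1
  have htop := (twoSum_exact hp hfl hT3.1 hT2.1).2
  have h := estimate_four_sign hp hfl hT1.2 hT3.2 hT4.2 hT4.1 hexp
    (by rw [htop]; rfl)
  simpa [List.sum_cons, add_assoc] using h

/-- **SIGN OF `estimate` ON THE BLOCK `B` OF `orient2dadapt`**
(`B = TWO-TWO-DIFF(TWO-PRODUCT(a, b), TWO-PRODUCT(c, d))` with error-free two-products):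
`estimate B > 0 → ab − cd > 0` and `estimate B < 0 → ab − cd < 0`. -/
theorem estimate_twoTwoProdDiff_sign (hp : 1 ≤ p) (hfl : IsRoundNearest p emin fl)
    (hfl2 : RoundoffBelow 2 fl) {tp : ℚ → ℚ → ℚ × ℚ} {a b c d : ℚ}
    (hab : ExactTwoProd p emin fl tp a b) (hcd : ExactTwoProd p emin fl tp c d) :
    (0 < estimate fl (twoTwoProdDiff tp fl a b c d) → 0 < a * b - c * d) ∧
      (estimate fl (twoTwoProdDiff tp fl a b c d) < 0 → a * b - c * d < 0) := by
  obtain ⟨hW, hS, -, -⟩ := twoTwoProdDiff_spec hp hfl hfl2 hab hcd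
  rw [← hS]
  exact estimate_twoTwoDiff_sign hp hfl hW.isExpansion

/-! ## Consequences for `orient2dadapt` -/

/-- `predicates.c`, `orient2dadapt`: the stage-B value `det = estimate(4, B)` with
`B = Two_Two_Diff(Two_Product(acx, bcy), Two_Product(acy, bcx))` on the rounded differences
`acx = a₁ ⊖ c₁, bcy = b₂ ⊖ c₂, acy = a₂ ⊖ c₂, bcx = b₁ ⊖ c₁`, over a two-product routine `tp`. -/
def orient2dDetB (tp : ℚ → ℚ → ℚ × ℚ) (fl : ℚ → ℚ) (a₁ a₂ b₁ b₂ c₁ c₂ : ℚ) : ℚ :=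
  estimate fl (twoTwoProdDiff tp fl (fl (a₁ - c₁)) (fl (b₂ - c₂)) (fl (a₂ - c₂)) (fl (b₁ - c₁)))

/-- **STAGE B, structural half.** Whenever the stage-B value `det` is nonzero it has the sign of the
determinant `x₁x₂ − x₃x₄` of the ROUNDED differences (error-free two-products assumed). In particular
the value returned by the stage-B test (`|det| ≥ errbound > 0`) has that sign; relating it to the sign
of the TRUE determinant is the stage-B error bound, not proved here. -/
theorem orient2dDetB_sign (hp : 1 ≤ p) (hfl : IsRoundNearest p emin fl) (hfl2 : RoundoffBelow 2 fl)
    {tp : ℚ → ℚ → ℚ × ℚ} {a₁ a₂ b₁ b₂ c₁ c₂ : ℚ}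
    (h₁₂ : ExactTwoProd p emin fl tp (fl (a₁ - c₁)) (fl (b₂ - c₂)))
    (h₃₄ : ExactTwoProd p emin fl tp (fl (a₂ - c₂)) (fl (b₁ - c₁))) :
    (0 < orient2dDetB tp fl a₁ a₂ b₁ b₂ c₁ c₂ →
        0 < fl (a₁ - c₁) * fl (b₂ - c₂) - fl (a₂ - c₂) * fl (b₁ - c₁)) ∧
      (orient2dDetB tp fl a₁ a₂ b₁ b₂ c₁ c₂ < 0 →
        fl (a₁ - c₁) * fl (b₂ - c₂) - fl (a₂ - c₂) * fl (b₁ - c₁) < 0) :=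
  estimate_twoTwoProdDiff_sign hp hfl hfl2 h₁₂ h₃₄

/-- **THE "ALL TAILS ZERO" EXIT NEVER RETURNS A WRONG STRICT SIGN.** If the four coordinate differences
are floats (their TWO-DIFF tails vanish, so `orient2dadapt` returns `det` right after stage B) then
`det > 0 →` the true determinant is `> 0` and `det < 0 →` it is `< 0` (error-free two-products assumed;
any round-to-nearest with the `RoundoffBelow 2` property, e.g. ties-to-even). -/
theorem orient2d_tailsZero_sign (hp : 1 ≤ p) (hfl : IsRoundNearest p emin fl) (hfl2 : RoundoffBelow 2 fl)
    {tp : ℚ → ℚ → ℚ × ℚ} {a₁ a₂ b₁ b₂ c₁ c₂ : ℚ} (h₁ : IsFloat p emin (a₁ - c₁))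
    (h₂ : IsFloat p emin (b₂ - c₂)) (h₃ : IsFloat p emin (a₂ - c₂)) (h₄ : IsFloat p emin (b₁ - c₁))
    (h₁₂ : ExactTwoProd p emin fl tp (a₁ - c₁) (b₂ - c₂))
    (h₃₄ : ExactTwoProd p emin fl tp (a₂ - c₂) (b₁ - c₁)) :
    (0 < orient2dDetB tp fl a₁ a₂ b₁ b₂ c₁ c₂ → 0 < (a₁ - c₁) * (b₂ - c₂) - (a₂ - c₂) * (b₁ - c₁)) ∧
      (orient2dDetB tp fl a₁ a₂ b₁ b₂ c₁ c₂ < 0 →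
        (a₁ - c₁) * (b₂ - c₂) - (a₂ - c₂) * (b₁ - c₁) < 0) := by
  have h := orient2dDetB_sign hp hfl hfl2 (tp := tp) (a₁ := a₁) (a₂ := a₂) (b₁ := b₁) (b₂ := b₂)
    (c₁ := c₁) (c₂ := c₂)
  rw [fl_eq_self hfl h₁, fl_eq_self hfl h₂, fl_eq_self hfl h₃, fl_eq_self hfl h₄] at h
  exact h h₁₂ h₃₄

/-- **The tails-zero exit with the FMA two-product and ties-to-even** (the binary64 build of
`predicates.c` on FMA hardware, scaled): coordinates in a format `F(p, e₀)` with `2e₀ ≥ emin` whose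
four differences happen to be `p`-bit floats — then every two-product is error-free and a nonzero
returned `det` has the sign of the true determinant. -/
theorem orient2d_tailsZero_fma (hp : 1 ≤ p) {e₀ : ℤ} (h2 : emin ≤ e₀ + e₀)
    {a₁ a₂ b₁ b₂ c₁ c₂ : ℚ} (ha₁ : IsFloat p e₀ a₁) (ha₂ : IsFloat p e₀ a₂) (hb₁ : IsFloat p e₀ b₁)
    (hb₂ : IsFloat p e₀ b₂) (hc₁ : IsFloat p e₀ c₁) (hc₂ : IsFloat p e₀ c₂)
    (h₁ : IsFloat p emin (a₁ - c₁)) (h₂ : IsFloat p emin (b₂ - c₂)) (h₃ : IsFloat p emin (a₂ - c₂))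
    (h₄ : IsFloat p emin (b₁ - c₁)) :
    (0 < orient2dDetB (twoProdFMA (roundTiesEven p emin)) (roundTiesEven p emin) a₁ a₂ b₁ b₂ c₁ c₂ →
        0 < (a₁ - c₁) * (b₂ - c₂) - (a₂ - c₂) * (b₁ - c₁)) ∧
      (orient2dDetB (twoProdFMA (roundTiesEven p emin)) (roundTiesEven p emin) a₁ a₂ b₁ b₂ c₁ c₂ < 0 →
        (a₁ - c₁) * (b₂ - c₂) - (a₂ - c₂) * (b₁ - c₁) < 0) := by
  have hfl : IsRoundNearest p emin (roundTiesEven p emin) := isRoundNearest_roundTiesEven hp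
  have hfl2 : RoundoffBelow 2 (roundTiesEven p emin) := roundoffBelow_two_roundTiesEven p emin
  -- a `p`-bit float on the grid `2^e₀ ℤ` is a float of `F(p, e₀)`
  have fmt : ∀ {x y : ℚ}, IsFloat p e₀ x → IsFloat p e₀ y → IsFloat p emin (x - y) →
      IsFloat p e₀ (x - y) := fun hx hy hxy =>
    isFloat_of_isFloat_of_onGrid hxy ((OnGrid.of_isFloat hx).sub (OnGrid.of_isFloat hy))
  exact orient2d_tailsZero_sign hp hfl hfl2 h₁ h₂ h₃ h₄
    (exactTwoProd_twoProdFMA hp hfl h2 (fmt ha₁ hc₁ h₁) (fmt hb₂ hc₂ h₂))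
    (exactTwoProd_twoProdFMA hp hfl h2 (fmt ha₂ hc₂ h₃) (fmt hb₁ hc₁ h₄))

/-- **The tails-zero exit with DEKKER's two-product and ties-to-even** (`predicates.c` as distributed:
split point `s` with `p ≤ 2s ≤ p + 1`, `p ≥ 4`): coordinates in `F(p, e₀)` with `e₀ ≥ emin + p − 1`
and `2e₀ ≥ emin + 2p − 1` (the no-underflow regime of Theorem 18) whose four differences are `p`-bit
floats — a nonzero returned `det` has the sign of the true determinant. -/
theorem orient2d_tailsZero_dekker (hp : 4 ≤ p) {s : ℕ} (hs2 : p ≤ 2 * s) (hs2' : 2 * s ≤ p + 1)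
    {e₀ : ℤ} (h1 : emin + p - 1 ≤ e₀) (h2 : emin + 2 * p - 1 ≤ e₀ + e₀)
    {a₁ a₂ b₁ b₂ c₁ c₂ : ℚ} (ha₁ : IsFloat p e₀ a₁) (ha₂ : IsFloat p e₀ a₂) (hb₁ : IsFloat p e₀ b₁)
    (hb₂ : IsFloat p e₀ b₂) (hc₁ : IsFloat p e₀ c₁) (hc₂ : IsFloat p e₀ c₂)
    (h₁ : IsFloat p emin (a₁ - c₁)) (h₂ : IsFloat p emin (b₂ - c₂)) (h₃ : IsFloat p emin (a₂ - c₂))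
    (h₄ : IsFloat p emin (b₁ - c₁)) :
    (0 < orient2dDetB (twoProduct (roundTiesEven p emin) s) (roundTiesEven p emin) a₁ a₂ b₁ b₂ c₁ c₂ →
        0 < (a₁ - c₁) * (b₂ - c₂) - (a₂ - c₂) * (b₁ - c₁)) ∧
      (orient2dDetB (twoProduct (roundTiesEven p emin) s) (roundTiesEven p emin) a₁ a₂ b₁ b₂ c₁ c₂ < 0 →
        (a₁ - c₁) * (b₂ - c₂) - (a₂ - c₂) * (b₁ - c₁) < 0) := by
  have hp1 : 1 ≤ p := le_trans (by norm_num) hp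
  have hfl : IsRoundNearest p emin (roundTiesEven p emin) := isRoundNearest_roundTiesEven hp1
  have hodd : ∀ t, roundTiesEven p emin (-t) = -roundTiesEven p emin t :=
    Literature.ComputerArithmetic.GraillatMuller2025.roundTiesEven_neg
  have hfl2 : RoundoffBelow 2 (roundTiesEven p emin) := roundoffBelow_two_roundTiesEven p emin
  have fmt : ∀ {x y : ℚ}, IsFloat p e₀ x → IsFloat p e₀ y → IsFloat p emin (x - y) →
      IsFloat p e₀ (x - y) := fun hx hy hxy =>
    isFloat_of_isFloat_of_onGrid hxy ((OnGrid.of_isFloat hx).sub (OnGrid.of_isFloat hy))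
  exact orient2d_tailsZero_sign hp1 hfl hfl2 h₁ h₂ h₃ h₄
    (exactTwoProd_twoProduct hp hs2 hs2' hfl hodd h1 h2 (fmt ha₁ hc₁ h₁) (fmt hb₂ hc₂ h₂))
    (exactTwoProd_twoProduct hp hs2 hs2' hfl hodd h1 h2 (fmt ha₂ hc₂ h₃) (fmt hb₁ hc₁ h₄))

end Summit.Ventures.CertifiedArithmetic.Expansions
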